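import Literature.NumberTheory.DiophantineApproximation.DilogTwoPointsLinearIndependence
import Literature.NumberTheory.DiophantineApproximation.DilogTwoPointsPade
import Literature.NumberTheory.Transcendental.ZetaLinearFormsCriterion
import Mathlib.Data.Nat.Choose.Bounds
import Mathlib.Data.Nat.Choose.Sum
import Mathlib.LinearAlgebra.Matrix.ToLinearEquiv
import Mathlib.RingTheory.Localization.Integer
import Mathlib.Analysis.SpecificLimits.Basic
import Mathlib.Analysis.Complex.ExponentialBounds
import Mathlib.Tactic.LinearCombination
import Mathlib.Tactic.FieldSimp
import Mathlib.Tactic.Positivity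
import HarnessLib

/-!
# Linear independence of `1, Li₁(±1/N), Li₂(±1/N)` over `ℚ` for `N ≥ 10⁸` — the discharge

Topic `Literature/NumberTheory/DiophantineApproximation`. This file PROVES the named fact
`DHK2020_dilogTwoPointsLinearIndependent` (`DilogTwoPointsLinearIndependence.lean`):
**for every integer `N ≥ 10⁸` the five numbers `1, Li₁(1/N), Li₂(1/N), Li₁(−1/N), Li₂(−1/N)`
(`Li_s = DilogPade.polylogSeries s`) are linearly independent over `ℚ`**
(`DHK2020_dilogTwoPointsLinearIndependent_holds`), the instance `K = ℚ`, `x = 0`, `r = m = 2`,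
`α = (1, −1)`, `β = N` of S. David, N. Hirata-Kohno, M. Kawashima, *Can polylogarithms at algebraic
points be linearly independent?*, Moscow J. Comb. Number Theory 9 (2020), Thm 2.1. The algebra of the
type-II Padé approximants `P_{n,l}` (Padé property [DHK2020, Thm 3.6], non-vanishing of the
determinant [DHK2020, Prop 5.1]) is in `DilogTwoPointsPade.lean`; here is the rest of the printed
proof ([DHK2020, §4]) and the assembly. No definitions, no named facts.

## Contents

* `intRelation_trivial_of_matrices` — the criterion [DHK2020, Prop 4.2] for `K = ℚ`: integer
  matrices `A_n` with `ℚ`-independent rows and `|A_{n,l,0} θ_j − A_{n,l,j}| → 0` force the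
  `ℚ`-linear independence of `1, θ_1, …, θ_m` (over `ℚ` the growth condition of Prop 4.2 is void:
  `V = 𝔸`; a nonzero integer has absolute value `≥ 1`).
* `isInt_lcmUpto_sq_mul_polyPart` — integrality: `lcm(1..M)² P_{n,l,α,s}(N) ∈ ℤ` ("the defect of
  integrality comes from our operators … corrected by a suitable power of `lcm(1,…,n)`", [DHK2020, §4]).
* `coeff_basePoly`, `sum_abs_padeCoeff_le` — `∑_k |p_{l,k}| ≤ 4^{6n+4}`.
* `remainder_bound` — the error term: by the Padé property,
  `P_{n,l}(N) Li_s(α/N) − P_{n,l,α,s}(N) = ∑_{j ≥ n} N^{−j−1} c_j` with `|c_j| ≤ ∑_k |p_{l,k}|`, so it is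
  `≤ 2 (∑_k |p_{l,k}|) N^{−n−1}`. DEVIATION: [DHK2020, Lemma 4.1] states finer estimates (proof
  deferred there to the sequels); over `ℚ` only the exponential rate in `N` matters and this crude
  bound gives the threshold `log N > 8 + 12 log 2 ≈ 16.3` (we use `N ≥ 10⁸`, `log N ≈ 18.4`; the
  paper's `V > 0` reads `log N > 8(1 + log(5/2)) + 2 log 3 ≈ 17.5`).
* `exists_pade_data` — with `d_n = lcm(1..4n+4) ≤ e^{(4+½)(n+1)}` (prime number theorem, tree lemma
  `eventually_lcmUpto_mul_le_exp`) the integer data `d_n² P_{n,l}(N)`, `d_n² P_{n,l,α,s}(N)` have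
  independent rows and remainders `≤ ⅛ (4⁶ e⁹/N)^{n+1} → 0` (`4⁶ e⁹ < 10⁸`).
* `DHK2020_dilogTwoPointsLinearIndependent_holds` — clearing denominators and the criterion.

References: S. David, N. Hirata-Kohno, M. Kawashima, Moscow J. Comb. Number Theory 9:4 (2020)
389–406 = arXiv:1912.03811, §2 (Thm 2.1), §3 (Thm 3.6), §4 (Lemma 4.1, Prop 4.2), §5 (Prop 5.1)
[DavidHirataKohnoKawashima2020].
-/

noncomputable section

open Finset Polynomial

namespace Literature.NumberTheory.DiophantineApproximation

namespace DilogTwoPoints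

/-! ## The linear independence criterion over `ℚ` ([DHK2020, Prop 4.2] with `K = ℚ`) -/

open scoped Matrix in
/-- **Invertible integer matrices with small remainders force independence**
([DavidHirataKohnoKawashima2020, Prop 4.2] for `K = ℚ`, where the growth condition disappears):
let `θ₁, …, θ_m` be real numbers and suppose that for every `ε > 0` there are integers `P_l`,
`Q_{l,i}` (`l = 0..m`, `i = 1..m`) whose rows `(P_l, Q_{l,·})` are linearly independent over `ℚ` and
with `|P_l θ_i − Q_{l,i}| < ε`. Then every integer relation `μ₀ + ∑ μ_i θ_i = 0` is trivial: for the
vector `μ = (μ₀, μ_1, …)`, `∑_j A_{l,j} μ_j = −∑_i μ_i (P_l θ_i − Q_{l,i})` is an integer of absolute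
value `< 1`, hence `0`, for every row `l`, contradicting `det A ≠ 0`.
[cite: DavidHirataKohnoKawashima2020, Prop 4.2] -/
theorem intRelation_trivial_of_matrices {m : ℕ} (θ : Fin m → ℝ)
    (hA : ∀ ε : ℝ, 0 < ε → ∃ (P : Fin (m + 1) → ℤ) (Q : Fin (m + 1) → Fin m → ℤ),
      (∀ c : Fin (m + 1) → ℚ, ∑ l, c l * (P l : ℚ) = 0 → (∀ i, ∑ l, c l * (Q l i : ℚ) = 0) →
        c = 0) ∧
      ∀ l i, |(P l : ℝ) * θ i - Q l i| < ε)
    (μ₀ : ℤ) (μ : Fin m → ℤ) (hrel : (μ₀ : ℝ) + ∑ i, (μ i : ℝ) * θ i = 0) :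
    μ₀ = 0 ∧ μ = 0 := by
  classical
  by_contra hne
  set S : ℝ := ∑ i, |(μ i : ℝ)| with hS
  have hS0 : 0 ≤ S := sum_nonneg fun i _ => abs_nonneg _
  obtain ⟨P, Q, hind, hsmall⟩ := hA (1 / (S + 1)) (by positivity)
  -- the integer matrix with rows `(P l, Q l ·)` and the vector `(μ₀, μ)`
  set A : Matrix (Fin (m + 1)) (Fin (m + 1)) ℤ := Matrix.of fun l j => Fin.cases (P l) (Q l) j
    with hAdef
  set lam : Fin (m + 1) → ℤ := Fin.cases μ₀ μ with hlamdef
  have hA0 : ∀ l, A l 0 = P l := fun l => by simp [hAdef]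
  have hAs : ∀ l i, A l i.succ = Q l i := fun l i => by simp [hAdef]
  have hlam0 : lam 0 = μ₀ := by simp [hlamdef]
  have hlams : ∀ i, lam i.succ = μ i := fun i => by simp [hlamdef]
  -- `det A ≠ 0` by the row independence over `ℚ`
  have hdet : A.det ≠ 0 := by
    intro hdet
    obtain ⟨v, hv, hvA⟩ := Matrix.exists_vecMul_eq_zero_iff.2 hdet
    have hvj : ∀ j, ∑ l, v l * A l j = 0 := fun j => by
      have := congrFun hvA j
      simpa [Matrix.vecMul, dotProduct] using this
    have hc := hind (fun l => (v l : ℚ)) ?_ ?_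
    · exact hv (funext fun l => by have := congrFun hc l; simpa using this)
    · have := hvj 0
      simp only [hA0] at this
      exact_mod_cast this
    · intro i
      have := hvj i.succ
      simp only [hAs] at this
      exact_mod_cast this
  have hlam : lam ≠ 0 := by
    intro h
    apply hne
    refine ⟨?_, funext fun i => ?_⟩
    · rw [← hlam0, h]; rfl
    · rw [← hlams i, h]; rfl
  have hAl : A *ᵥ lam ≠ 0 := fun h =>
    hdet (Matrix.exists_mulVec_eq_zero_iff.1 ⟨lam, hlam, h⟩)
  obtain ⟨l, hl⟩ := Function.ne_iff.1 hAl
  -- the `l`-th entry of `A λ` is `P_l μ₀ + ∑ Q_{l,i} μ_i = -∑ μ_i (P_l θ_i - Q_{l,i})`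
  have hexp : (((A *ᵥ lam) l : ℤ) : ℝ) = (P l : ℝ) * μ₀ + ∑ i, (Q l i : ℝ) * μ i := by
    simp only [Matrix.mulVec, dotProduct, Fin.sum_univ_succ, hA0, hAs, hlam0, hlams]
    push_cast
    ring
  have hval : (((A *ᵥ lam) l : ℤ) : ℝ) = -∑ i, (μ i : ℝ) * ((P l : ℝ) * θ i - Q l i) := by
    have h1 : ∑ i, (μ i : ℝ) * ((P l : ℝ) * θ i - Q l i) =
        (P l : ℝ) * ∑ i, (μ i : ℝ) * θ i - ∑ i, (Q l i : ℝ) * μ i := by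
      rw [mul_sum, ← sum_sub_distrib]
      exact sum_congr rfl fun i _ => by ring
    have h2 : ∑ i, (μ i : ℝ) * θ i = -(μ₀ : ℝ) := by linarith
    rw [hexp, h1, h2]
    ring
  have hbound : |(((A *ᵥ lam) l : ℤ) : ℝ)| < 1 := by
    rw [hval, abs_neg]
    calc |∑ i, (μ i : ℝ) * ((P l : ℝ) * θ i - Q l i)|
        ≤ ∑ i, |(μ i : ℝ)| * (1 / (S + 1)) := by
          refine (abs_sum_le_sum_abs _ _).trans (sum_le_sum fun i _ => ?_)
          rw [abs_mul]
          exact mul_le_mul_of_nonneg_left (hsmall l i).le (abs_nonneg _)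
      _ = S * (1 / (S + 1)) := by rw [← sum_mul]
      _ < 1 := by
          rw [mul_one_div, div_lt_one (by positivity)]
          linarith
  have hge : (1 : ℝ) ≤ |(((A *ᵥ lam) l : ℤ) : ℝ)| := by
    rw [← Int.cast_abs]
    exact_mod_cast Int.one_le_abs hl
  linarith

/-! ## Integrality of the polynomial parts after multiplication by `lcm(1..M)²` -/

/-- `lcm(1, …, M)² · P_{l,α,s}(N) ∈ ℤ`: every denominator `(t+1)^s` (`t + 1 ≤ M`, `s ≤ 2`) of
`∑_k p_k ∑_{t<k} N^{k−1−t} α^{t+1}/(t+1)^s` divides `lcm(1..M)²` ("the defect of integrality … is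
corrected by multiplying by a suitable power of `lcm(1, …, n)`", [DavidHirataKohnoKawashima2020, §4]).
[cite: DavidHirataKohnoKawashima2020, §4] -/
theorem isInt_lcmUpto_sq_mul_polyPart (p : ℕ → ℤ) {K M : ℕ} (hKM : K ≤ M + 1) (α : ℤ) {s : ℕ}
    (hs : s ≤ 2) (N : ℕ) :
    ∃ z : ℤ, (z : ℚ) = (Nat.lcmUpto M : ℚ) ^ 2 * ∑ k ∈ range K, (p k : ℚ) *
      ∑ t ∈ range k, (N : ℚ) ^ (k - 1 - t) * (α : ℚ) ^ (t + 1) / ((t : ℚ) + 1) ^ s := by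
  set d := Nat.lcmUpto M with hd
  have hdvd : ∀ t : ℕ, t + 1 ≤ M → t + 1 ∣ d := fun t ht => by
    rw [hd, Nat.lcmUpto]
    exact Finset.dvd_lcm (Finset.mem_Icc.2 ⟨Nat.succ_le_succ (Nat.zero_le _), ht⟩)
  refine ⟨∑ k ∈ range K, p k * ∑ t ∈ range k,
    (N : ℤ) ^ (k - 1 - t) * α ^ (t + 1) * ((t : ℤ) + 1) ^ (2 - s) * ((d / (t + 1) : ℕ) : ℤ) ^ 2, ?_⟩
  push_cast
  simp only [Finset.mul_sum]
  refine sum_congr rfl fun k hk => sum_congr rfl fun t ht => ?_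
  have htM : t + 1 ≤ M := by
    have := mem_range.1 hk
    have := mem_range.1 ht
    omega
  have ht0 : ((t : ℚ) + 1) ≠ 0 := by positivity
  have hdvd' : ((t : ℤ) + 1) ∣ (d : ℤ) := by exact_mod_cast hdvd t htM
  have hcast : (((d : ℤ) / ((t : ℤ) + 1) : ℤ) : ℚ) = (d : ℚ) / ((t : ℚ) + 1) := by
    rw [Int.cast_div hdvd' (by push_cast; positivity)]
    push_cast
    rfl
  rw [hcast, div_pow, show ((t : ℚ) + 1) ^ 2 = ((t : ℚ) + 1) ^ (2 - s) * ((t : ℚ) + 1) ^ s by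
    rw [← pow_add, Nat.sub_add_cancel hs]]
  field_simp

/-! ## The size of the coefficients `p_{l,k}` -/

/-- The coefficients of `T^l (T² − 1)^{2n}`: `a_{l,k} = (−1)^{2n−i} C(2n, i)` if `k = l + 2i`, else `0`.
[folklore] -/
theorem coeff_basePoly (n l k : ℕ) :
    (X ^ l * (X ^ 2 - 1) ^ (2 * n) : ℤ[X]).coeff k =
      ∑ i ∈ range (2 * n + 1), if k = l + 2 * i then (-1) ^ (2 * n - i) * ((2 * n).choose i : ℤ)
        else 0 := by
  rw [sub_eq_add_neg, add_pow, mul_sum, finsetSum_coeff]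
  refine sum_congr rfl fun i _ => ?_
  have h : (X ^ l * ((X ^ 2) ^ i * (-1) ^ (2 * n - i) * ((2 * n).choose i : ℤ[X])) : ℤ[X]) =
      C ((-1) ^ (2 * n - i) * ((2 * n).choose i : ℤ)) * X ^ (l + 2 * i) := by
    rw [← pow_mul, pow_add, C_mul, C_pow, C_neg, C_1, ← Polynomial.C_eq_natCast]
    ring
  rw [h, coeff_C_mul_X_pow]

/-- **Size of the coefficients**: `∑_k |p_{l,k}| = ∑_i C(2n,i) C(l+2i+n, n)² ≤ 4^n · 4^{5n+4}` for
`l ≤ 4` (crude: `C(k+n, n) ≤ 2^{k+n} ≤ 2^{5n+4}` and `∑_i C(2n, i) = 4^n`). This replaces the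
finer estimate of [DavidHirataKohnoKawashima2020, Lemma 4.1]; only exponential size matters.
[folklore] -/
theorem sum_abs_padeCoeff_le (n l : ℕ) (hl : l ≤ 4) :
    ∑ k ∈ range (4 * n + 5),
      |(((X ^ l * (X ^ 2 - 1) ^ (2 * n) : ℤ[X]).coeff k * ((k + n).choose n : ℤ) ^ 2 : ℤ) : ℝ)| ≤
        (4 : ℝ) ^ (6 * n + 4) := by
  have hW : ∀ k ∈ range (4 * n + 5), (((k + n).choose n : ℤ) : ℝ) ^ 2 ≤ (4 : ℝ) ^ (5 * n + 4) := by
    intro k hk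
    have hk' := mem_range.1 hk
    have h1 : ((k + n).choose n : ℝ) ≤ (2 : ℝ) ^ (k + n) := by
      exact_mod_cast Nat.choose_le_two_pow (k + n) n
    have h2 : (2 : ℝ) ^ (k + n) ≤ (2 : ℝ) ^ (5 * n + 4) :=
      pow_le_pow_right₀ (by norm_num) (by omega)
    calc (((k + n).choose n : ℤ) : ℝ) ^ 2 = ((k + n).choose n : ℝ) ^ 2 := by push_cast; ring
      _ ≤ ((2 : ℝ) ^ (5 * n + 4)) ^ 2 :=
          pow_le_pow_left₀ (by positivity) (h1.trans h2) 2
      _ = (4 : ℝ) ^ (5 * n + 4) := by rw [← pow_mul, pow_mul']; norm_num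
  -- `|a_{l,k}| ≤ ∑_i [k = l + 2i] C(2n, i)`
  have ha : ∀ k : ℕ, |(((X ^ l * (X ^ 2 - 1) ^ (2 * n) : ℤ[X]).coeff k : ℤ) : ℝ)| ≤
      ∑ i ∈ range (2 * n + 1), if k = l + 2 * i then ((2 * n).choose i : ℝ) else 0 := by
    intro k
    rw [coeff_basePoly]
    push_cast
    refine (abs_sum_le_sum_abs _ _).trans (sum_le_sum fun i _ => ?_)
    split_ifs
    · rw [abs_mul, abs_pow, abs_neg, abs_one, one_pow, one_mul, Nat.abs_cast]
    · rw [abs_zero]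
  calc ∑ k ∈ range (4 * n + 5),
        |(((X ^ l * (X ^ 2 - 1) ^ (2 * n) : ℤ[X]).coeff k * ((k + n).choose n : ℤ) ^ 2 : ℤ) : ℝ)|
      ≤ ∑ k ∈ range (4 * n + 5), (∑ i ∈ range (2 * n + 1),
          if k = l + 2 * i then ((2 * n).choose i : ℝ) else 0) * (4 : ℝ) ^ (5 * n + 4) := by
        refine sum_le_sum fun k hk => ?_
        rw [Int.cast_mul, abs_mul, Int.cast_pow,
          abs_of_nonneg (sq_nonneg (((((k + n).choose n : ℕ) : ℤ) : ℝ)))]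
        exact mul_le_mul (ha k) (hW k hk) (sq_nonneg _)
          (sum_nonneg fun i _ => by split_ifs <;> positivity)
    _ = (∑ i ∈ range (2 * n + 1), ((2 * n).choose i : ℝ)) * (4 : ℝ) ^ (5 * n + 4) := by
        rw [← sum_mul, sum_comm]
        congr 1
        refine sum_congr rfl fun i hi => ?_
        rw [sum_ite_eq', if_pos (mem_range.2 (by have := mem_range.1 hi; omega))]
    _ = (4 : ℝ) ^ (6 * n + 4) := by
        have h : ∑ i ∈ range (2 * n + 1), ((2 * n).choose i : ℝ) = (4 : ℝ) ^ n := by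
          have := Nat.sum_range_choose (2 * n)
          have h' : ((∑ i ∈ range (2 * n + 1), (2 * n).choose i : ℕ) : ℝ) = (2 : ℝ) ^ (2 * n) := by
            rw [this]; push_cast; ring
          push_cast at h'
          rw [h', pow_mul]; norm_num
        rw [h, ← pow_add]
        congr 1
        ring

/-! ## The remainder `P_{n,l}(N) Li_s(α/N) − P_{n,l,α,s}(N)` -/

/-- Summability of the polylogarithm series `∑ x^{t+1}/(t+1)^s` for `|x| ≤ 1/2`. [folklore] -/
theorem summable_polylog_of_abs_le (s : ℕ) {x : ℝ} (hx : |x| ≤ 1 / 2) :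
    Summable fun t : ℕ => x ^ (t + 1) / ((t : ℝ) + 1) ^ s := by
  refine Summable.of_norm_bounded (g := fun t : ℕ => (1 / 2 : ℝ) ^ t)
    (summable_geometric_of_lt_one (by norm_num) (by norm_num)) (fun t => ?_)
  rw [Real.norm_eq_abs, abs_div, abs_pow, abs_pow]
  have h1 : (1 : ℝ) ≤ |(t : ℝ) + 1| ^ s := by
    rw [abs_of_nonneg (by positivity)]
    exact one_le_pow₀ (by linarith [Nat.cast_nonneg (α := ℝ) t])
  calc |x| ^ (t + 1) / |(t : ℝ) + 1| ^ s ≤ |x| ^ (t + 1) := div_le_self (by positivity) h1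
    _ ≤ (1 / 2 : ℝ) ^ (t + 1) := pow_le_pow_left₀ (abs_nonneg _) hx _
    _ ≤ (1 / 2 : ℝ) ^ t := pow_le_pow_of_le_one (by norm_num) (by norm_num) (by omega)

/-- **The remainder of the Padé approximation is small** (the metric input of
[DavidHirataKohnoKawashima2020, §4, Lemma 4.1 (error term)], in the crude form sufficient over `ℚ`):
if the coefficients `p_k` satisfy the Padé orthogonality for `j < n` (weight `α^{k+j+1}/(k+j+1)^s`,
`|α| = 1`), then for real `N ≥ 2`
`|P(N)·Li_s(α/N) − ∑_k p_k ∑_{t<k} N^{k−1−t} α^{t+1}/(t+1)^s| ≤ 2 (∑_k |p_k|) N^{−n−1}`: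
indeed the difference is `∑_{j ≥ 0} N^{−j−1} c_j` with `c_j = ∑_k p_k α^{k+j+1}/(k+j+1)^s`, `c_j = 0`
for `j < n` and `|c_j| ≤ ∑_k |p_k|`. [cite: DavidHirataKohnoKawashima2020, Thm 3.6 and Lemma 4.1] -/
theorem remainder_bound {K n s : ℕ} (p : ℕ → ℤ) {α : ℝ} (hα : |α| = 1) {N : ℝ} (hN : 2 ≤ N)
    (horth : ∀ j < n, ∑ k ∈ range K, (p k : ℝ) * α ^ (k + j + 1) / ((k : ℝ) + j + 1) ^ s = 0) :
    |(∑ k ∈ range K, (p k : ℝ) * N ^ k) * DilogPade.polylogSeries s (α / N) -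
        ∑ k ∈ range K, (p k : ℝ) *
          ∑ t ∈ range k, N ^ (k - 1 - t) * α ^ (t + 1) / ((t : ℝ) + 1) ^ s| ≤
      2 * (∑ k ∈ range K, |(p k : ℝ)|) / N ^ (n + 1) := by
  have hN0 : (0 : ℝ) < N := by linarith
  have hN0' : (N : ℝ) ≠ 0 := hN0.ne'
  have hxabs : |α / N| ≤ 1 / 2 := by
    rw [abs_div, hα, abs_of_pos hN0]
    exact one_div_le_one_div_of_le (by norm_num) hN
  set f : ℕ → ℝ := fun t => (α / N) ^ (t + 1) / ((t : ℝ) + 1) ^ s with hf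
  have hfs : Summable f := summable_polylog_of_abs_le s hxabs
  have hLi : DilogPade.polylogSeries s (α / N) = ∑' t, f t := rfl
  -- the tail of the series after `k` terms
  have htail : ∀ k : ℕ, (N : ℝ) ^ k * DilogPade.polylogSeries s (α / N) -
      N ^ k * ∑ t ∈ range k, f t = N ^ k * ∑' t, f (t + k) := by
    intro k
    rw [hLi, ← hfs.sum_add_tsum_nat_add k]
    ring
  -- the finite parts are the polynomial parts
  have hfin : ∀ k : ℕ, (N : ℝ) ^ k * ∑ t ∈ range k, f t =
      ∑ t ∈ range k, N ^ (k - 1 - t) * α ^ (t + 1) / ((t : ℝ) + 1) ^ s := by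
    intro k
    rw [mul_sum]
    refine sum_congr rfl fun t ht => ?_
    have ht' := mem_range.1 ht
    have hpow : (N : ℝ) ^ k = N ^ (k - 1 - t) * N ^ (t + 1) := by
      rw [← pow_add]; congr 1; omega
    simp only [hf, div_pow]
    rw [hpow]
    field_simp
  -- the tail terms
  have hterm : ∀ k t : ℕ, (N : ℝ) ^ k * f (t + k) =
      (1 / N) ^ (t + 1) * (α ^ (k + t + 1) / ((k : ℝ) + t + 1) ^ s) := by
    intro k t
    simp only [hf, div_pow, one_div, inv_pow]
    have hpow : (N : ℝ) ^ (t + k + 1) = N ^ k * N ^ (t + 1) := by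
      rw [← pow_add]; congr 1; omega
    rw [hpow]
    push_cast
    field_simp
    ring
  -- the difference as a sum of tails
  have hdiff : (∑ k ∈ range K, (p k : ℝ) * N ^ k) * DilogPade.polylogSeries s (α / N) -
      ∑ k ∈ range K, (p k : ℝ) *
        ∑ t ∈ range k, N ^ (k - 1 - t) * α ^ (t + 1) / ((t : ℝ) + 1) ^ s =
      ∑ k ∈ range K, (p k : ℝ) * (N ^ k * ∑' t, f (t + k)) := by
    rw [sum_mul, ← sum_sub_distrib]
    refine sum_congr rfl fun k _ => ?_
    rw [← htail k, hfin k]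
    ring
  -- exchange the finite sum and the series
  set c : ℕ → ℝ := fun t => ∑ k ∈ range K, (p k : ℝ) * (α ^ (k + t + 1) / ((k : ℝ) + t + 1) ^ s)
    with hc
  have hsumk : ∀ k, Summable fun t => f (t + k) := fun k => (summable_nat_add_iff k).2 hfs
  have hsumk' : ∀ k, Summable fun t =>
      (p k : ℝ) * ((1 / N) ^ (t + 1) * (α ^ (k + t + 1) / ((k : ℝ) + t + 1) ^ s)) := by
    intro k
    refine ((hsumk k).mul_left ((p k : ℝ) * N ^ k)).congr fun t => ?_
    rw [mul_assoc, hterm]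
  have hswap : ∑ k ∈ range K, (p k : ℝ) * (N ^ k * ∑' t, f (t + k)) =
      ∑' t, (1 / N) ^ (t + 1) * c t := by
    have h1 : ∀ k ∈ range K, (p k : ℝ) * (N ^ k * ∑' t, f (t + k)) =
        ∑' t, (p k : ℝ) * ((1 / N) ^ (t + 1) * (α ^ (k + t + 1) / ((k : ℝ) + t + 1) ^ s)) := by
      intro k _
      rw [← tsum_mul_left, ← tsum_mul_left]
      exact tsum_congr fun t => by rw [hterm]
    rw [sum_congr rfl h1, ← Summable.tsum_finsetSum (fun k _ => hsumk' k)]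
    refine tsum_congr fun t => ?_
    simp only [hc, mul_sum]
    exact sum_congr rfl fun k _ => by ring
  -- `c_t = 0` for `t < n` and `|c_t| ≤ H`
  have hc0 : ∀ t < n, c t = 0 := by
    intro t ht
    simp only [hc]
    rw [← horth t ht]
    exact sum_congr rfl fun k _ => by ring
  set H : ℝ := ∑ k ∈ range K, |(p k : ℝ)| with hH
  have hH0 : 0 ≤ H := sum_nonneg fun k _ => abs_nonneg _
  have hcle : ∀ t, |c t| ≤ H := by
    intro t
    simp only [hc, hH]
    refine (abs_sum_le_sum_abs _ _).trans (sum_le_sum fun k _ => ?_)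
    rw [abs_mul]
    refine mul_le_of_le_one_right (abs_nonneg _) ?_
    rw [abs_div, abs_pow, hα, one_pow, abs_of_nonneg (by positivity)]
    refine div_le_one_of_le₀ ?_ (by positivity)
    exact one_le_pow₀ (by linarith [Nat.cast_nonneg (α := ℝ) k, Nat.cast_nonneg (α := ℝ) t])
  -- the series of tails, shifted by `n`
  set g : ℕ → ℝ := fun t => (1 / N) ^ (t + 1) * c t with hg
  have hq0 : (0 : ℝ) ≤ 1 / N := by positivity
  have hq1 : (1 : ℝ) / N ≤ 1 / 2 := one_div_le_one_div_of_le (by norm_num) hN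
  have hgeom : Summable fun t : ℕ => (1 / N : ℝ) ^ t :=
    summable_geometric_of_lt_one hq0 (by linarith)
  have hgbound : ∀ t, ‖g (t + n)‖ ≤ H * (1 / N) ^ (n + 1) * (1 / N) ^ t := by
    intro t
    rw [Real.norm_eq_abs, hg]
    simp only
    rw [abs_mul, abs_pow, abs_of_nonneg hq0]
    calc (1 / N : ℝ) ^ (t + n + 1) * |c (t + n)| ≤ (1 / N : ℝ) ^ (t + n + 1) * H :=
          mul_le_mul_of_nonneg_left (hcle _) (by positivity)
      _ = H * (1 / N) ^ (n + 1) * (1 / N) ^ t := by ring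
  have hgs' : Summable fun t => ‖g (t + n)‖ :=
    Summable.of_nonneg_of_le (fun t => norm_nonneg _) hgbound
      ((hgeom.mul_left (H * (1 / N) ^ (n + 1))))
  have hgs : Summable g := by
    rw [← summable_nat_add_iff n]
    exact hgs'.of_norm
  have hshift : ∑' t, g t = ∑' t, g (t + n) := by
    rw [← hgs.sum_add_tsum_nat_add n, sum_eq_zero (fun t ht => ?_), zero_add]
    rw [hg]
    simp only
    rw [hc0 t (mem_range.1 ht), mul_zero]
  have hinv : (1 - 1 / N : ℝ)⁻¹ ≤ 2 := by
    rw [inv_le_comm₀ (by linarith) (by norm_num)]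
    linarith
  calc |(∑ k ∈ range K, (p k : ℝ) * N ^ k) * DilogPade.polylogSeries s (α / N) -
        ∑ k ∈ range K, (p k : ℝ) *
          ∑ t ∈ range k, N ^ (k - 1 - t) * α ^ (t + 1) / ((t : ℝ) + 1) ^ s|
      = ‖∑' t, g (t + n)‖ := by rw [hdiff, hswap, hshift, Real.norm_eq_abs]
    _ ≤ ∑' t, ‖g (t + n)‖ := norm_tsum_le_tsum_norm hgs'
    _ ≤ ∑' t, H * (1 / N) ^ (n + 1) * (1 / N) ^ t :=
        hgs'.tsum_le_tsum hgbound (hgeom.mul_left _)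
    _ = H * (1 / N) ^ (n + 1) * (1 - 1 / N)⁻¹ := by
        rw [tsum_mul_left, tsum_geometric_of_lt_one hq0 (by linarith)]
    _ ≤ H * (1 / N) ^ (n + 1) * 2 := mul_le_mul_of_nonneg_left hinv (by positivity)
    _ = 2 * H / N ^ (n + 1) := by rw [one_div_pow]; ring

/-! ## Numerics and the Padé data at `N ≥ 10⁸` -/

/-- `4⁶ e⁹ < 10⁸` (`e⁹ < 8104`). [folklore] -/
theorem four_pow_six_mul_exp_nine_lt : (4 : ℝ) ^ 6 * Real.exp 9 < 10 ^ 8 := by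
  have h := Real.exp_one_lt_d9
  have h9 : Real.exp 9 = Real.exp 1 ^ 9 := by
    rw [← Real.exp_nat_mul]
    norm_num
  rw [h9]
  have h' : Real.exp 1 ^ 9 < (2.7182818286 : ℝ) ^ 9 :=
    pow_lt_pow_left₀ h (Real.exp_pos 1).le (by norm_num)
  calc (4 : ℝ) ^ 6 * Real.exp 1 ^ 9 < 4 ^ 6 * (2.7182818286 : ℝ) ^ 9 := by
        exact mul_lt_mul_of_pos_left h' (by norm_num)
    _ < 10 ^ 8 := by norm_num

/-- **The Padé data** ([DavidHirataKohnoKawashima2020], proof of Thm 2.1 for `K = ℚ`, `x = 0`,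
`r = m = 2`, `α = (1,−1)`, `β = N ≥ 10⁸`): for every `ε > 0` there are integers
`P_l = d_n² P_{n,l}(N)` and `Q_{l,(α,s)} = d_n² P_{n,l,α,s}(N)` (`d_n = lcm(1..4n+4)`, `n` large),
with `ℚ`-linearly independent rows (`pade_rows_independent_inst`) and
`|P_l Li_s(α/N) − Q_{l,(α,s)}| ≤ d_n² · 2·4^{6n+4} N^{−n−1} ≤ ⅛ (4⁶e⁹/N)^{n+1} < ε`
(`d_n ≤ e^{(4+½)(n+1)}` by the prime number theorem, `4⁶ e⁹ < 10⁸ ≤ N`). The index `i : Fin 4`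
encodes `(α, s) = (1,1), (1,2), (−1,1), (−1,2)`. [cite: DavidHirataKohnoKawashima2020, Thm 2.1] -/
theorem exists_pade_data (N : ℕ) (hN : 10 ^ 8 ≤ N) {ε : ℝ} (hε : 0 < ε) :
    ∃ (P : Fin 5 → ℤ) (Q : Fin 5 → Fin 4 → ℤ),
      (∀ c : Fin 5 → ℚ, ∑ l, c l * (P l : ℚ) = 0 → (∀ i, ∑ l, c l * (Q l i : ℚ) = 0) → c = 0) ∧
      ∀ (l : Fin 5) (i : Fin 4),
        |(P l : ℝ) * DilogPade.polylogSeries ((![1, 2, 1, 2] : Fin 4 → ℕ) i)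
            ((((![1, 1, -1, -1] : Fin 4 → ℤ) i : ℤ) : ℝ) / N) - Q l i| < ε := by
  have hl4 : ∀ l : Fin 5, (l : ℕ) ≤ 4 := fun l => Nat.le_of_lt_succ l.is_lt
  have hNr : (10 : ℝ) ^ 8 ≤ N := by exact_mod_cast hN
  have hN2 : (2 : ℝ) ≤ N := le_trans (by norm_num) hNr
  have hN0 : (0 : ℝ) < N := by linarith
  -- the ratio `q = 4⁶ e⁹ / N < 1`
  set q : ℝ := (4 : ℝ) ^ 6 * Real.exp 9 / N with hq
  have hq0 : 0 ≤ q := by positivity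
  have hq1 : q < 1 := by
    rw [hq, div_lt_one hN0]
    exact four_pow_six_mul_exp_nine_lt.trans_le hNr
  -- choose `n`
  have hev1 : ∀ᶠ n : ℕ in Filter.atTop,
      (Nat.lcmUpto (4 * (n + 1)) : ℝ) ≤ Real.exp ((4 + 1 / 2) * ((n + 1 : ℕ) : ℝ)) := by
    have h := Literature.NumberTheory.Transcendental.eventually_lcmUpto_mul_le_exp 4
      (ε := 1 / 2) (by norm_num)
    exact (Filter.tendsto_add_atTop_nat 1).eventually h
  have hev2 : ∀ᶠ n : ℕ in Filter.atTop, (1 / 8 : ℝ) * q ^ (n + 1) < ε := by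
    have ht : Filter.Tendsto (fun n : ℕ => (1 / 8 : ℝ) * q ^ (n + 1)) Filter.atTop (nhds 0) := by
      have h1 := (tendsto_pow_atTop_nhds_zero_of_lt_one hq0 hq1).comp
        (Filter.tendsto_add_atTop_nat 1)
      have h2 := h1.const_mul (1 / 8 : ℝ)
      rw [mul_zero] at h2
      exact h2
    exact ht.eventually (Iio_mem_nhds hε)
  obtain ⟨n, hn1, hn2⟩ := (hev1.and hev2).exists
  -- the data
  set d : ℕ := Nat.lcmUpto (4 * (n + 1)) with hd
  have hdpos : 0 < d := Nat.lcmUpto_pos _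
  set p : ℕ → ℕ → ℤ := fun l k =>
    (X ^ l * (X ^ 2 - 1) ^ (2 * n) : ℤ[X]).coeff k * ((k + n).choose n : ℤ) ^ 2 with hp
  set αv : Fin 4 → ℤ := ![1, 1, -1, -1] with hαv
  set sv : Fin 4 → ℕ := ![1, 2, 1, 2] with hsv
  have hαv' : ∀ i, αv i = 1 ∨ αv i = -1 := by
    intro i; fin_cases i <;> simp [hαv]
  have hsv' : ∀ i, sv i = 1 ∨ sv i = 2 := by
    intro i; fin_cases i <;> simp [hsv]
  have hsv1 : ∀ i, 1 ≤ sv i := fun i => by rcases hsv' i with h | h <;> omega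
  have hsv2 : ∀ i, sv i ≤ 2 := fun i => by rcases hsv' i with h | h <;> omega
  set P : Fin 5 → ℤ := fun l => (d : ℤ) ^ 2 * ∑ k ∈ range (4 * n + 5), p l k * (N : ℤ) ^ k
    with hP
  have hQex : ∀ (l : Fin 5) (i : Fin 4), ∃ z : ℤ, (z : ℚ) = (d : ℚ) ^ 2 *
      ∑ k ∈ range (4 * n + 5), (p l k : ℚ) *
        ∑ t ∈ range k, (N : ℚ) ^ (k - 1 - t) * (αv i : ℚ) ^ (t + 1) / ((t : ℚ) + 1) ^ (sv i) :=
    fun l i => isInt_lcmUpto_sq_mul_polyPart (p l) (K := 4 * n + 5) (M := 4 * (n + 1))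
      (by omega) (αv i) (hsv2 i) N
  choose Q hQ using hQex
  -- the Padé orthogonality, over `ℚ` and over `ℝ`
  have horthQ : ∀ (l : Fin 5), ∀ j < n, ∀ s : ℕ, (s = 1 ∨ s = 2) → ∀ α : ℚ, (α = 1 ∨ α = -1) →
      ∑ k ∈ range (4 * n + 5), (p l k : ℚ) * α ^ (k + j + 1) / ((k : ℚ) + j + 1) ^ s = 0 := by
    intro l j hj s hs α hα
    have h := pade_orthogonality n l (hl4 l) hj (s := s) (by rcases hs with rfl | rfl <;> norm_num)
      (by rcases hs with rfl | rfl <;> norm_num) hα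
    rw [← h]
    refine sum_congr rfl fun k _ => ?_
    simp only [hp]
    push_cast
    ring
  refine ⟨P, Q, ?_, ?_⟩
  · -- row independence
    intro c hcP hcQ
    have hd0 : (d : ℚ) ^ 2 ≠ 0 := by positivity
    refine pade_rows_independent_inst n (N : ℚ) c ?_ ?_
    · have h1 : (d : ℚ) ^ 2 * ∑ l : Fin 5, c l * ∑ k ∈ range (4 * n + 5),
          (p l k : ℚ) * (N : ℚ) ^ k = 0 := by
        rw [mul_sum, ← hcP]
        refine sum_congr rfl fun l _ => ?_
        simp only [hP]
        push_cast
        ring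
      have h2 := (mul_eq_zero.1 h1).resolve_left hd0
      rw [← h2]
      refine sum_congr rfl fun l _ => ?_
      congr 1
      refine sum_congr rfl fun k _ => ?_
      simp only [hp]
      push_cast
      ring
    · intro α hα s hs
      obtain ⟨i, hi1, hi2⟩ : ∃ i : Fin 4, (αv i : ℚ) = α ∧ sv i = s := by
        rcases hα with rfl | rfl <;> rcases hs with rfl | rfl
        · exact ⟨0, by simp [hαv], by simp [hsv]⟩
        · exact ⟨1, by simp [hαv], by simp [hsv]⟩
        · exact ⟨2, by simp [hαv], by simp [hsv]⟩
        · exact ⟨3, by simp [hαv], by simp [hsv]⟩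
      have h1 : (d : ℚ) ^ 2 * ∑ l : Fin 5, c l * ∑ k ∈ range (4 * n + 5), (p l k : ℚ) *
          ∑ t ∈ range k, (N : ℚ) ^ (k - 1 - t) * α ^ (t + 1) / ((t : ℚ) + 1) ^ s = 0 := by
        rw [mul_sum, ← hcQ i]
        refine sum_congr rfl fun l _ => ?_
        rw [hQ l i, hi1, hi2]
        ring
      have h2 := (mul_eq_zero.1 h1).resolve_left hd0
      rw [← h2]
      refine sum_congr rfl fun l _ => ?_
      congr 1
      refine sum_congr rfl fun k _ => ?_
      simp only [hp]
      push_cast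
      ring
  · -- smallness
    intro l i
    have hαR : |((αv i : ℤ) : ℝ)| = 1 := by
      rcases hαv' i with h | h <;> simp [h]
    -- the remainder bound for this row and column
    have horthR : ∀ j < n, ∑ k ∈ range (4 * n + 5),
        (p l k : ℝ) * ((αv i : ℤ) : ℝ) ^ (k + j + 1) / ((k : ℝ) + j + 1) ^ (sv i) = 0 := by
      intro j hj
      have h := congrArg (Rat.cast : ℚ → ℝ) (horthQ l j hj (sv i) (hsv' i) (αv i)
        (by rcases hαv' i with h | h <;> simp [h]))
      push_cast at h
      simpa using h
    have hR := remainder_bound (K := 4 * n + 5) (n := n) (s := sv i) (p l) hαR hN2 horthR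
    have hH := sum_abs_padeCoeff_le n l (hl4 l)
    -- casting the integer data to `ℝ`
    have hPR : (P l : ℝ) = (d : ℝ) ^ 2 * ∑ k ∈ range (4 * n + 5), (p l k : ℝ) * (N : ℝ) ^ k := by
      simp only [hP]
      push_cast
      rfl
    have hQR : (Q l i : ℝ) = (d : ℝ) ^ 2 * ∑ k ∈ range (4 * n + 5), (p l k : ℝ) *
        ∑ t ∈ range k, (N : ℝ) ^ (k - 1 - t) * ((αv i : ℤ) : ℝ) ^ (t + 1) /
          ((t : ℝ) + 1) ^ (sv i) := by
      have h := congrArg (Rat.cast : ℚ → ℝ) (hQ l i)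
      push_cast at h
      exact h
    -- the denominators
    have hd2 : (d : ℝ) ^ 2 ≤ Real.exp 9 ^ (n + 1) := by
      have h1 : (d : ℝ) ^ 2 ≤ (Real.exp ((4 + 1 / 2) * ((n + 1 : ℕ) : ℝ))) ^ 2 :=
        pow_le_pow_left₀ (by positivity) hn1 2
      have h2 : (Real.exp ((4 + 1 / 2) * ((n + 1 : ℕ) : ℝ))) ^ 2 = Real.exp 9 ^ (n + 1) := by
        rw [← Real.exp_nat_mul, ← Real.exp_nat_mul]
        congr 1
        push_cast
        ring
      exact h1.trans_eq h2
    have hHp : ∑ k ∈ range (4 * n + 5), |(p l k : ℝ)| ≤ (4 : ℝ) ^ (6 * n + 4) := by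
      simpa only [hp] using hH
    show |(P l : ℝ) * DilogPade.polylogSeries (sv i) (((αv i : ℤ) : ℝ) / N) - Q l i| < ε
    rw [hPR, hQR, mul_assoc, ← mul_sub, abs_mul, abs_of_nonneg (by positivity)]
    calc (d : ℝ) ^ 2 * |(∑ k ∈ range (4 * n + 5), (p l k : ℝ) * (N : ℝ) ^ k) *
            DilogPade.polylogSeries (sv i) (((αv i : ℤ) : ℝ) / N) -
          ∑ k ∈ range (4 * n + 5), (p l k : ℝ) *
            ∑ t ∈ range k, (N : ℝ) ^ (k - 1 - t) * ((αv i : ℤ) : ℝ) ^ (t + 1) /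
              ((t : ℝ) + 1) ^ (sv i)|
        ≤ Real.exp 9 ^ (n + 1) * (2 * (4 : ℝ) ^ (6 * n + 4) / N ^ (n + 1)) := by
          refine mul_le_mul hd2 (hR.trans ?_) (abs_nonneg _) (by positivity)
          exact div_le_div_of_nonneg_right (by linarith) (by positivity)
      _ = (1 / 8 : ℝ) * q ^ (n + 1) := by
          rw [hq, div_pow, mul_pow,
            show (4 : ℝ) ^ (6 * n + 4) = ((4 : ℝ) ^ 6) ^ n * 4 ^ 4 by rw [← pow_mul, ← pow_add]]
          field_simp
          ring
      _ < ε := hn2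

end DilogTwoPoints

/-! ## The discharge -/

open DilogTwoPoints

/-- **Linear independence of `1, Li₁(1/N), Li₂(1/N), Li₁(−1/N), Li₂(−1/N)` over `ℚ` for
`N ≥ 10⁸`** — discharge of the named fact `DHK2020_dilogTwoPointsLinearIndependent`
([DavidHirataKohnoKawashima2020, Thm 2.1] with `K = ℚ`, `x = 0`, `r = m = 2`, `α = (1, −1)`,
`β = N`). Proof: the type-II Padé approximants of [DHK2020, §3] (`DilogTwoPointsPade.lean`) give, for
every `ε`, integer matrices with `ℚ`-independent rows (non-vanishing determinant, [DHK2020, Prop 5.1])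
and remainders `< ε` (`exists_pade_data`); the criterion [DHK2020, Prop 4.2] over `ℚ`
(`intRelation_trivial_of_matrices`) applies to the integer relation obtained by clearing denominators.
[cite: DavidHirataKohnoKawashima2020, Thm 2.1] -/
theorem DHK2020_dilogTwoPointsLinearIndependent_holds : DHK2020_dilogTwoPointsLinearIndependent := by
  intro N hN a b₁ c₁ b₂ c₂ hrel
  -- clear denominators
  set v : Fin 5 → ℚ := ![a, b₁, c₁, b₂, c₂] with hv
  obtain ⟨⟨B, hB⟩, hint⟩ :=
    IsLocalization.exist_integer_multiples_of_finite (nonZeroDivisors ℤ) v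
  choose μ hμ using hint
  have hB0 : (B : ℚ) ≠ 0 := by exact_mod_cast nonZeroDivisors.ne_zero hB
  have hμ' : ∀ i, (μ i : ℚ) = (B : ℚ) * v i := fun i => by
    have h := hμ i
    simp only [zsmul_eq_mul] at h
    rw [← h]
    simp
  -- the numbers `θ` and the integer relation
  set θ : Fin 4 → ℝ := fun i => DilogPade.polylogSeries ((![1, 2, 1, 2] : Fin 4 → ℕ) i)
    ((((![1, 1, -1, -1] : Fin 4 → ℤ) i : ℤ) : ℝ) / N) with hθ
  have hrelZ : ((μ 0 : ℤ) : ℝ) + ∑ i : Fin 4, ((μ i.succ : ℤ) : ℝ) * θ i = 0 := by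
    have hcast : ∀ i, ((μ i : ℤ) : ℝ) = (B : ℝ) * (v i : ℝ) := fun i => by
      have := congrArg (Rat.cast : ℚ → ℝ) (hμ' i)
      push_cast at this
      exact this
    simp only [Fin.sum_univ_four, hcast, hθ, hv]
    simp only [Fin.succ_zero_eq_one, Fin.succ_one_eq_two, Matrix.cons_val_zero, Matrix.cons_val_one,
      Matrix.cons_val]
    push_cast
    have e : ((-1 : ℝ)) / (N : ℝ) = -(1 / (N : ℝ)) := by ring
    simp only [e]
    linear_combination (B : ℝ) * hrel
  obtain ⟨h0, hsucc⟩ := intRelation_trivial_of_matrices θ (fun ε hε => exists_pade_data N hN hε)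
    (μ 0) (fun i => μ i.succ) hrelZ
  have hμ0 : ∀ i : Fin 5, μ i = 0 := by
    intro i
    refine Fin.cases h0 (fun j => ?_) i
    exact congrFun hsucc j
  have hv0 : ∀ i : Fin 5, v i = 0 := fun i => by
    have h := hμ' i
    rw [hμ0 i, Int.cast_zero] at h
    exact (mul_eq_zero.1 h.symm).resolve_left hB0
  refine ⟨?_, ?_, ?_, ?_, ?_⟩
  · simpa [hv] using hv0 0
  · simpa [hv] using hv0 1
  · simpa [hv] using hv0 2
  · simpa [hv] using hv0 3
  · simpa [hv] using hv0 4

end Literature.NumberTheory.DiophantineApproximation
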